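import Literature.AlgebraicGeometry.ShimuraVarieties.FramedConeLattice
import Literature.AlgebraicGeometry.ShimuraVarieties.CompactBallQuotientProjectiveEmbedding
import Literature.NumberTheory.Automorphic.PicardCMPrerequisites
import Literature.NumberTheory.Automorphic.UnitaryGroupCongruenceDiscontinuous
import Literature.AlgebraicGeometry.Motives.ChowConeChow
import Literature.NumberTheory.Transcendental.ProjectiveSpaceProofs
import Literature.NumberTheory.Transcendental.ProjectiveSpaceT2Proofs
import Literature.Geometry.Kaehler.AnalyticSetImmersedImage
import Literature.AlgebraicGeometry.Motives.GAGAAlgebraisation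
import Literature.AlgebraicGeometry.Motives.ProjectiveManifoldSmooth
import HarnessLib

/-!
# `PicardCM.BallQuotientUniformised` from lattice discontinuity and the projective embedding of `Δ\𝔹²`

ASSEMBLY.  The displayed binder `h₁ = PicardCM.BallQuotientUniformised` of the COR-CM E term `hc_cm_of_PerLFace`
(via `ballQuotientUniformisedDatum_of`) — "compact arithmetic ball quotients are smooth projective surfaces uniformised
by the ball of negative lines" (`NumberTheory/Automorphic/PicardCMPrerequisites.lean` :281, five clauses
`IsBallUniformisation` :235) — is PROVED here from two inputs:

* **R0** (the inline hypothesis `hK1` of `ballQuotientUniformised_of`, stated over the binders of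
  the record, and IN THE TREE: `UnitaryGroup.properlyDiscontinuousSMul_archImageU21_of_signature` /
  `isCancelSMul_archImageU21_of_signature` of `NumberTheory/Automorphic/UnitaryGroupCongruenceDiscontinuous.lean` plugged in by `ballQuotientUniformised_of_embedding`): the lattice
  `Δ = {T⁻¹ γ^{τ₁} T | γ ∈ Γ} = FramedCone.lattice Γ T hT = UnitaryGroup.archImageU21 … Γ ≤ U(2,1)` acts PROPERLY
  DISCONTINUOUSLY and FREELY on the tree's ball `BallModel.Ball`;
* **R4** (the named fact `compactBallQuotient_projectiveEmbedding` of
  `ShimuraVarieties/CompactBallQuotientProjectiveEmbedding.lean`: Shafarevich BAG 2, IX §3.2 Theorem; Kollár 1995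
  Thm. 5.22): compact free quotients `Δ\𝔹²` admit an injective holomorphic immersion into some `ℙᴺ(ℂ)`.

Construction.  `Δ\𝔹² = MulAction.orbitRel.Quotient Δ Ball` is a compact complex surface (manifold structure
`BallModel.instIsManifoldQuotient`; compactness from the tree's X-free cocompactness
`UnitaryGroup.compactSpace_U21_quotient_archImageU21_of_signature_of_isCongruenceSubgroup` and
`BallModel.compactSpace_quotient_of_compactSpace_quotientGroup`).  Its image under the embedding `F` of R4 is a closed
analytic subset of `ℙᴺ(ℂ)` (`Literature.Geometry.Kaehler.isAnalyticSet_range_of_immersion`), hence projective algebraic (Chow,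
`Motives.isProjAlgebraicSet_of_isAnalyticSet_holds`); the reduced closed subscheme `X ⊆ ℙᴺ_ℂ` under it is ANALYTIFIED
by `Δ\𝔹²` (`Literature.AlgebraicGeometry.Motives.SerreGAGA.exists_isAnalytification_of_isProjAlgebraicSet_range`: `φ : Δ\𝔹² → X(ℂ)` an `IsAnalytification`) and SMOOTH PROJECTIVE of
dimension `2` (`Literature.AlgebraicGeometry.Motives.ProjectiveManifold.isSmoothProjective_of_isAnalytification`) — the tree's algebraisation pipeline for compact complex
manifolds immersed in `ℙᴺ(ℂ)` .  The uniformisation is `unif = φ ∘ coneProj`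
(`FramedCone.coneProj v = Δ · proj (T⁻¹ v)`, extended by a junk value off the cone, `FramedCone.coneExtend`), and the
FIVE clauses of `IsBallUniformisation E H Γ X unif` are `isBallUniformisation_unif`: continuity / openness / surjectivity
from `FramedCone.continuous_coneProj` / `isOpenMap_coneProj` / `coneProj_surjective` and `φ` a homeomorphism; the fibre
clause `unif v = unif w ↔ ∃ γ ∈ Γ, ∃ c ≠ 0, γ^{τ₁} v = c • w` from `FramedCone.coneProj_eq_iff`; holomorphy of
`evalOrZero U s ∘ unif` above affine opens from `IsAnalytification.mdifferentiableOn_evalOrZero` and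
`FramedCone.differentiableAt_coneExtend_comp_coneProj`.

Main results: `ballQuotientUniformised_of (hK1 : R0) (hEmb : compactBallQuotient_projectiveEmbedding) :
PicardCM.BallQuotientUniformised` and, with R0 plugged in from the tree,
**`ballQuotientUniformised_of_embedding (hEmb : compactBallQuotient_projectiveEmbedding) : PicardCM.BallQuotientUniformised`**
— the binder `h₁` of the E term rests on the single analytic record R4.

References: I. R. Shafarevich, *Basic Algebraic Geometry 2* (1994), Book 3 Ch. IX §3.1–3.2; J. Kollár, *Shafarevich
Maps and Automorphic Forms* (1995), Thm. 5.22; D. Mumford, *Algebraic Geometry I* (1981), (4.6), (4.14);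
N. Bergeron, J. Millson, C. Moeglin, Acta Math. 216 (2016), Introduction §1.1, Part 2 §1.3.

Provenance: Literature home (namespace `Literature.AlgebraicGeometry.ShimuraVarieties.BallQuotient`) of the Summits-side `HodgeConjecture/CorCM/Geometry/BallQuotientUniformisedOf` (imports `Literature/` and Mathlib only), re-homed so that the Literature named facts it proves are discharged Literature-side under their exact names. Lane `lit-hodgefound`, seat p20.
-/

set_option autoImplicit false

noncomputable section

open scoped Manifold ContDiff Matrix _root_.Topology ComplexOrder
open Set Function MulAction Matrix NumberField
open Literature.Geometry.ComplexHyperbolic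
open Literature.Geometry.ComplexHyperbolic.BallModel (U21 Ball Q proj lift mat x₀ nsq)
open Literature.AlgebraicGeometry.ShimuraVarieties (hermForm negCone mem_negCone_iff isOpen_negCone
  smul_mem_negCone signatureMatrix conjRingHom unitaryGroup mem_unitaryGroup_iff IsCongruenceSubgroup
  compactBallQuotient_projectiveEmbedding)
open Literature.AlgebraicGeometry.ShimuraVarieties.FramedCone
open Literature.AlgebraicGeometry.Motives (SchemeOver ComplexPoints AlgPoints IsSmoothProjective)
open Literature.NumberTheory.Transcendental (IsAnalytification IsProjAlgebraicSet projPoint)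
open Literature.NumberTheory.Automorphic
open Literature.NumberTheory.Automorphic.UnitaryGroup

namespace Literature.AlgebraicGeometry.ShimuraVarieties.BallQuotient

/-! ## 6. The assembly -/

section Assembly

variable {E : Subfield ℂ} [NumberField E] [IsCMField E] {H : Matrix (Fin 3) (Fin 3) E}
  {Γ : Subgroup (GL (Fin 3) E)} (hΓ : IsCongruenceSubgroup (conjRingHom E) H Γ)
  (T : GL (Fin 3) ℂ)
  (hT : (T : Matrix (Fin 3) (Fin 3) ℂ)ᴴ * H.map E.subtype * (T : Matrix (Fin 3) (Fin 3) ℂ) = signatureMatrix 2)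
  [ProperlyDiscontinuousSMul (lattice Γ T hT) Ball] [IsCancelSMul (lattice Γ T hT) Ball]
  {X : SchemeOver ℂ} {φ : orbitRel.Quotient (lattice Γ T hT) Ball → ComplexPoints X}

/-- **The uniformisation attached to an analytification `φ : Δ\𝔹² → X(ℂ)`**: `unif = φ ∘ mk ∘ coneChart` on
the negative cone (junk off it). [cite: BergeronMillsonMoeglin2016Balls, Introduction §1.1] -/
def unif (φ : orbitRel.Quotient (lattice Γ T hT) Ball → ComplexPoints X) : (Fin 3 → ℂ) → ComplexPoints X :=
  coneExtend (φ ∘ coneProj T hT (Γ := Γ)) (φ (Literature.Geometry.Manifold.QuotientManifold.mk x₀))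

include hΓ in
/-- **The five uniformisation clauses** of `PicardCM.IsBallUniformisation` for `unif = φ ∘ mk ∘ coneChart`,
`φ` an analytification of a smooth `X/ℂ` by `Δ\𝔹²`. [cite: BergeronMillsonMoeglin2016Balls, Introduction §1.1, Part 2 §1.3] -/
theorem isBallUniformisation_unif (hφ : IsAnalytification (Fin 2 → ℂ) X 2 φ) :
    PicardCM.IsBallUniformisation E H Γ X (unif T hT φ) := by
  have hπc := continuous_coneProj T hT (Γ := Γ)
  refine ⟨?_, ?_, ?_, ?_, ?_⟩
  · -- continuity on the cone
    rw [continuousOn_iff_continuous_restrict, unif, restrict_coneExtend]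
    exact hφ.isHomeomorph.continuous.comp hπc
  · -- openness on the cone
    rw [unif, restrict_coneExtend]
    exact hφ.isHomeomorph.isOpenMap.comp (isOpenMap_coneProj T hT (Γ := Γ))
  · -- onto `X(ℂ)`
    intro P _
    obtain ⟨q, rfl⟩ := hφ.isHomeomorph.surjective P
    obtain ⟨v, rfl⟩ := coneProj_surjective T hT (Γ := Γ) q
    exact ⟨v, v.2, coneExtend_of_mem _ _ v.2⟩
  · -- fibres
    intro v hv w hw
    rw [unif, coneExtend_of_mem _ _ hv, coneExtend_of_mem _ _ hw, Function.comp_apply, Function.comp_apply,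
      hφ.isHomeomorph.injective.eq_iff]
    exact coneProj_eq_iff hΓ T hT ⟨v, hv⟩ ⟨w, hw⟩
  · -- holomorphy in algebraic coordinates
    intro U s
    set W : Set (orbitRel.Quotient (lattice Γ T hT) Ball) := φ ⁻¹' {P | P.pt ∈ (↑U : X.left.Opens)} with hW
    have hWo : IsOpen W := hφ.isOpen_preimage _
    have hk : MDifferentiableOn 𝓘(ℂ, Fin 2 → ℂ) 𝓘(ℂ, ℂ)
        (fun m ↦ AlgPoints.evalOrZero (↑U : X.left.Opens) s (φ m)) W :=
      hφ.mdifferentiableOn_evalOrZero U s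
    intro v₀ hv₀
    obtain ⟨hv₀c, hv₀U⟩ := hv₀
    have hq : coneProj T hT (Γ := Γ) ⟨v₀, hv₀c⟩ ∈ W := by
      rw [hW, mem_preimage]
      simpa [unif, coneExtend_of_mem _ _ hv₀c] using hv₀U
    have hkAt := (hk _ hq).mdifferentiableAt (hWo.mem_nhds hq)
    have hd := differentiableAt_coneExtend_comp_coneProj T hT hv₀c
      (AlgPoints.evalOrZero (↑U : X.left.Opens) s (φ (Literature.Geometry.Manifold.QuotientManifold.mk x₀))) hkAt
    refine (hd.congr_of_eventuallyEq ?_).differentiableWithinAt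
    filter_upwards with w
    by_cases hw : w ∈ negCone (H.map E.subtype)
    · rw [unif, coneExtend_of_mem _ _ hw, coneExtend_of_mem _ _ hw]
      rfl
    · simp only [unif, coneExtend, dif_neg hw]

end Assembly

open scoped _root_.LinearAlgebra.Projectivization in
/-- **`PicardCM.BallQuotientUniformised` from R0 and R4.**  Given (R0, hypothesis `hK1`, = stated
over the binders of the record plus a frame) the proper discontinuity and freeness on `𝔹²` of the arithmetic lattices
`FramedCone.lattice Γ T hT = UnitaryGroup.archImageU21 … Γ`, and (R4, `hEmb`) the projective embedding of compact free
ball quotients (`compactBallQuotient_projectiveEmbedding`, Shafarevich IX §3.2 / Kollár Thm 5.22), every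
datum `(E, H, Γ)` of the record is uniformised: `Δ\𝔹²` is a compact complex surface (cocompactness:
`UnitaryGroup.compactSpace_U21_quotient_archImageU21_of_signature_of_isCongruenceSubgroup`; manifold:
`BallModel.instIsManifoldQuotient`), its image in `ℙᴺ(ℂ)` is analytic (`Literature.Geometry.Kaehler.isAnalyticSet_range_of_immersion`)
hence algebraic (Chow, `Motives.isProjAlgebraicSet_of_isAnalyticSet_holds`), the reduced closed subscheme
`X ⊆ ℙᴺ_ℂ` under it is analytified by `Δ\𝔹²` (`SerreGAGA.exists_isAnalytification_of_isProjAlgebraicSet_range`) and smooth projective of dimension `2`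
(`ProjectiveManifold.isSmoothProjective_of_isAnalytification`), and `unif = φ ∘ mk ∘ coneChart` satisfies the five clauses
(`isBallUniformisation_unif`).
[cite: Shafarevich1994, Book 3 Ch. IX §3.2 Theorem] [cite: Mumford1981, (4.6) Corollary, p. 61; (4.14) Corollary]
[cite: BergeronMillsonMoeglin2016Balls, Introduction §1.1] -/
theorem ballQuotientUniformised_of
    (hK1 : ∀ (E : Subfield ℂ) [NumberField E] [IsCMField E] (H : Matrix (Fin 3) (Fin 3) E)
      (Γ : Subgroup (GL (Fin 3) E)),
      (∀ i j, conjRingHom E (H i j) = H j i) →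
      (∀ v : Fin 3 → E, hermForm (conjRingHom E) H v v = 0 → v = 0) →
      ∀ (T : GL (Fin 3) ℂ)
        (hT : (T : Matrix (Fin 3) (Fin 3) ℂ)ᴴ * H.map E.subtype * (T : Matrix (Fin 3) (Fin 3) ℂ) =
          signatureMatrix 2),
      (∀ τ : E →+* ℂ, InfinitePlace.mk τ ≠ InfinitePlace.mk E.subtype → (H.map τ).PosDef) →
      IsCongruenceSubgroup (conjRingHom E) H Γ →
      (∀ γ ∈ Γ, IsOfFinOrder γ → γ = 1) →
        ProperlyDiscontinuousSMul (lattice Γ T hT) Ball ∧ IsCancelSMul (lattice Γ T hT) Ball)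
    (hEmb : compactBallQuotient_projectiveEmbedding) : PicardCM.BallQuotientUniformised := by
  intro E _ _ H Γ hherm hanis hsig hpos hΓ htf
  obtain ⟨T, hT⟩ := hsig
  obtain ⟨hPD, hfree⟩ := hK1 E H Γ hherm hanis T hT hpos hΓ htf
  haveI : CompactSpace (U21 ⧸ lattice Γ T hT) :=
    compactSpace_U21_quotient_archImageU21_of_signature_of_isCongruenceSubgroup H hanis hT hΓ
  haveI : CompactSpace (orbitRel.Quotient (lattice Γ T hT) Ball) :=
    BallModel.compactSpace_quotient_of_compactSpace_quotientGroup _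
  obtain ⟨N, F, hF, hFinj, hFimm⟩ := hEmb (lattice Γ T hT)
  haveI : IsManifold 𝓘(ℂ, Fin N → ℂ) ω (ℙ ℂ (Fin (N + 1) → ℂ)) :=
    Literature.NumberTheory.Transcendental.isManifold_projectivization_holds ℂ N
  haveI : T2Space (ℙ ℂ (Fin (N + 1) → ℂ)) :=
    Literature.NumberTheory.Transcendental.t2Space_projectivization_holds ℂ N
  have hAn : Literature.Geometry.Kaehler.IsAnalyticSet 𝓘(ℂ, Fin N → ℂ) (range F) :=
    Literature.Geometry.Kaehler.isAnalyticSet_range_of_immersion F hF hFinj hFimm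
  have hcl : IsClosed (range F) := (isCompact_range hF.continuous).isClosed
  have hAlg : IsProjAlgebraicSet (range F) :=
    Literature.AlgebraicGeometry.Motives.isProjAlgebraicSet_of_isAnalyticSet_holds (n := N) hcl hAn
  obtain ⟨X, ιX, hιX, hXred, φ, hφ, hcomp⟩ := Literature.AlgebraicGeometry.Motives.SerreGAGA.exists_isAnalytification_of_isProjAlgebraicSet_range F hF hFinj hAlg
  haveI := hιX
  haveI := hXred
  have hX : IsSmoothProjective 2 X :=
    Literature.AlgebraicGeometry.Motives.ProjectiveManifold.isSmoothProjective_of_isAnalytification F hF hFinj hFimm ιX φ hφ hcomp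
  exact ⟨X, unif T hT φ, hX, isBallUniformisation_unif hΓ T hT hφ⟩

/-- **`h₁` of the COR-CM E term from ONE analytic record.**  `PicardCM.BallQuotientUniformised` follows from the
projective embedding of compact free ball quotients (`compactBallQuotient_projectiveEmbedding`, Shafarevich IX §3.2 /
Kollár Thm 5.22) alone: the discontinuity/freeness input R0 of `ballQuotientUniformised_of` is the tree's
`UnitaryGroup.properlyDiscontinuousSMul_archImageU21_of_signature` / `isCancelSMul_archImageU21_of_signature`
(`UnitaryGroupCongruenceDiscontinuous.lean`, ). [cite: Shafarevich1994, Book 3 Ch. IX §3.2 Theorem]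
[cite: Kollar1995, Ch. 5 Thm. 5.22] -/
theorem ballQuotientUniformised_of_embedding (hEmb : compactBallQuotient_projectiveEmbedding) :
    PicardCM.BallQuotientUniformised :=
  ballQuotientUniformised_of
    (fun _E _ _ H _Γ _ _ _T hT hpos hΓ htf ↦
      ⟨properlyDiscontinuousSMul_archImageU21_of_signature H hT hpos hΓ,
        isCancelSMul_archImageU21_of_signature H hT hpos hΓ htf⟩)
    hEmb

end Literature.AlgebraicGeometry.ShimuraVarieties.BallQuotient

end
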